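import Summits.NavierStokesRegularity.NavierStokesRegularity.Theses.AxisymmetricExtremality
import Summits.NavierStokesRegularity.NavierStokesRegularity.Theorems.CertifiedBlowupCertifiedBlowupAxisymBlowupKatoLifespan
import Summits.NavierStokesRegularity.NavierStokesRegularity.Theorems.AxisymmetricExtremalityClayDatumCritical

/-!
# Strategist census s20-g11 — kernel companion (crux `AxisymmetricKatoGlobal`, item
# stmt-NavierStokesRegularity-15453, route AxisymmetricExtremality)

Nothing here is a line (no `stub_*`, no sorry). It certifies the typed claims of
`STRATEGY-CENSUS-s20.md` (gen 11, family `-s`, independent):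

* § Summit-down: `NoAxisymMinimalDatum` (W) is what `closes` actually consumes —
  `w_of_crux : AxisymmetricKatoGlobal → W` and `closes_of_w : MinimalDatumPFold → PFoldToAxisymmetric → W →
  NavierStokesRegularity` (same proof term as the route's `closes`).
* § Decomposition D-e: `AxisymClayKatoGlobal` (AXS = ns.S25 in Kato form) and `ClassTransfer`
  (AXS → crux); assembly `crux_of_split` (modus ponens = trivial seam); `axs_of_summit : S → AXS`
  (AXS is on-path) and `axs_iff_leaf : AXS ↔ AxisymmetricSwirlRegularity` (the hard piece IS the
  registered conjecture leaf ns.S25, open since 1968).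
* § Strengthen: `AprioriCriticalBound` (S⁺: a scale-invariant a-priori bound for axisymmetric Kato
  solutions) — typed only; no implication claimed in-kernel.
-/

set_option linter.dupNamespace false

namespace Summit.NavierStokesRegularity.NavierStokesRegularity.Cruxes.AxisymmetricKatoGlobal.StrategistS20g11

open Summit.NavierStokesRegularity.NavierStokesRegularity.Theses.AxisymmetricExtremality
open Literature.Analysis.FluidPDE Literature.Analysis.FunctionSpaces
open Summit.NavierStokesRegularity.NavierStokesRegularity.Theorems.CertifiedBlowupAxisymBlowup.CompactAmplification
open scoped ENNReal ContDiff

/-- The route's axisymmetry clause, verbatim (`= IsAxisymmetric u₀` unfolded). -/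
def AxEqv (u₀ : EuclideanSpace ℝ (Fin 3) → EuclideanSpace ℝ (Fin 3)) : Prop :=
  ∀ (θ : ℝ) (x : EuclideanSpace ℝ (Fin 3)),
    u₀ (WithLp.toLp 2 ![Real.cos θ * x 0 - Real.sin θ * x 1, Real.sin θ * x 0 + Real.cos θ * x 1, x 2]) =
      WithLp.toLp 2 ![Real.cos θ * u₀ x 0 - Real.sin θ * u₀ x 1, Real.sin θ * u₀ x 0 + Real.cos θ * u₀ x 1, u₀ x 2]

theorem axEqv_iff_isAxisymmetric (u₀ : EuclideanSpace ℝ (Fin 3) → EuclideanSpace ℝ (Fin 3)) :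
    AxEqv u₀ ↔ IsAxisymmetric u₀ := Iff.rfl

/-! ## Summit-down: the threshold instance W -/

/-- **W** — no axisymmetric Ḣ^{1/2}-minimal blow-up datum (for any ν > 0). This is the only
instance of the crux that the route's deciding theorem `closes` consumes. -/
def NoAxisymMinimalDatum : Prop :=
  ∀ ν : ℝ, 0 < ν → ∀ (u₀ : EuclideanSpace ℝ (Fin 3) → EuclideanSpace ℝ (Fin 3))
    (g : HomSobolev (EuclideanSpace ℝ (Fin 3)) (EuclideanSpace ℂ (Fin 3)) (1 / 2 : ℝ)),
    IsMinimalBlowupDatum ν u₀ g → AxEqv u₀ → False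

/-- crux ⇒ W (one line: a minimal blow-up datum is L³, represented, weakly div-free and NOT
globally Kato-solvable). -/
theorem w_of_crux (h : AxisymmetricKatoGlobal) : NoAxisymMinimalDatum := by
  intro ν hν u₀ g hmin hax
  obtain ⟨hL3, hrep, hdiv, -, hnot⟩ := hmin
  exact hnot (h ν hν u₀ g hL3 hrep hdiv hax)

/-- The route closes from W in place of the crux — literally the proof term of `closes`. -/
theorem closes_of_w (h₂ : MinimalDatumPFold) (h₄ : PFoldToAxisymmetric) (hW : NoAxisymMinimalDatum) :
    _root_.NavierStokesRegularity := by
  show Literature.NS.NavierStokesExistenceSmoothR3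
  intro ν hν u₀ hsm hdiv hdec
  by_contra hno
  obtain ⟨u₁, g, hmin, hax⟩ := h₄ ν hν (h₂ ν hν ⟨u₀, hsm, hdiv, hdec, hno⟩)
  exact hW ν hν u₁ g hmin hax

/-! ## Decomposition D-e: Clay-class core ∧ class transfer -/

/-- **AXS** — ns.S25 in Kato form: every smooth, divergence-free, rapidly decaying, axisymmetric
datum has a global Kato (C_t L³) solution, for every ν > 0. -/
def AxisymClayKatoGlobal : Prop :=
  ∀ ν : ℝ, 0 < ν → ∀ u₀ : EuclideanSpace ℝ (Fin 3) → EuclideanSpace ℝ (Fin 3),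
    ContDiff ℝ (⊤ : ℕ∞) u₀ → NSWave0.IsDivFree u₀ → HasRapidSpatialDecay u₀ → AxEqv u₀ →
      HasGlobalKatoSolution ν u₀

/-- **Class transfer** — the critical-class dressing of the crux as a separate piece: regularity for
Clay-class axisymmetric data upgrades to global Kato solvability of every axisymmetric
L³ ∩ Ḣ^{1/2} weakly divergence-free datum (incl. unbounded initial swirl Γ₀ = r u_θ and
non-L² tails). Not soft: the set of globally Kato-solvable data is OPEN, so approximation by
Schwartz data needs bounds uniform in the approximation. -/
def ClassTransfer : Prop := AxisymClayKatoGlobal → AxisymmetricKatoGlobal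

/-- Assembly of D-e (trivial seam: modus ponens). -/
theorem crux_of_split (h₁ : AxisymClayKatoGlobal) (h₂ : ClassTransfer) : AxisymmetricKatoGlobal := h₂ h₁

/-- AXS is ON-PATH: the summit implies it (Clay solution ⇒ T_max^{Kato} = ⊤ ⇒ global Kato solution,
tree theorems `navierStokesRegularity_iff_forall_katoMaximalTime_eq_top`,
`hasGlobalKatoSolution_of_katoMaximalTime_eq_top`, `kato_unique_holds`). -/
theorem axs_of_summit (hS : _root_.NavierStokesRegularity) : AxisymClayKatoGlobal := by
  intro ν hν u₀ hsm hdiv hdec _hax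
  have hdiv' : VectorCalculus.IsDivFree u₀ := fun x => hdiv x
  exact hasGlobalKatoSolution_of_katoMaximalTime_eq_top kato_unique_holds hν
    ((navierStokesRegularity_iff_forall_katoMaximalTime_eq_top.1 hS) ν hν u₀ hsm hdiv' hdec)

/-- AXS **is** the registered conjecture leaf ns.S25 (`AxisymmetricSwirlRegularity`, Clay-solution
form), via Kato's lifespan (`axisymmetricSwirlRegularity_iff_forall_katoMaximalTime_eq_top`,
`katoMaximalTime_eq_top_iff`). -/
theorem axs_iff_leaf :
    AxisymClayKatoGlobal ↔ Summit.NavierStokesRegularity.NavierStokesRegularity.AxisymmetricSwirlRegularity := by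
  have e : Summit.NavierStokesRegularity.NavierStokesRegularity.AxisymmetricSwirlRegularity ↔
      Literature.Analysis.FluidPDE.AxisymmetricSwirlRegularity := Iff.rfl
  rw [e, axisymmetricSwirlRegularity_iff_forall_katoMaximalTime_eq_top]
  constructor
  · intro h ν hν u₀ hsm hdiv hdec hax
    have hdiv' : NSWave0.IsDivFree u₀ := fun x => hdiv x
    exact (katoMaximalTime_eq_top_iff kato_unique_holds hν).2 (h ν hν u₀ hsm hdiv' hdec hax)
  · intro h ν hν u₀ hsm hdiv hdec hax
    have hdiv' : VectorCalculus.IsDivFree u₀ := fun x => hdiv x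
    exact (katoMaximalTime_eq_top_iff kato_unique_holds hν).1 (h ν hν u₀ hsm hdiv' hdec hax)

/-- Hence the crux implies ns.S25 outright (the crux is at least the leaf; the converse is the
open `ClassTransfer`). -/
theorem leaf_of_crux (h : AxisymmetricKatoGlobal) :
    Summit.NavierStokesRegularity.NavierStokesRegularity.AxisymmetricSwirlRegularity := by
  refine axs_iff_leaf.1 ?_
  intro ν hν u₀ hsm hdiv hdec hax
  obtain ⟨hL3, hwdiv, g, hrep⟩ :=
    Summit.NavierStokesRegularity.NavierStokesRegularity.Theorems.axisymmetricExtremality_clayDatumCritical_proof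
      u₀ hsm hdiv hdec
  exact h ν hν u₀ g hL3 hrep hwdiv hax

/-! ## Strengthen: the a-priori critical bound S⁺ (typed only) -/

/-- **S⁺** — a scale-invariant a-priori bound: every Kato solution from an axisymmetric Clay datum
stays bounded in L³ on its interval of existence by a function of the datum alone. With
Escauriaza–Seregin–Šverák (L^∞_t L³_x ⇒ regular) this gives AXS; obtaining it is Type-I-type
information, i.e. the whole difficulty (census § Strengthen). -/
def AprioriCriticalBound : Prop :=
  ∀ ν : ℝ, 0 < ν → ∀ u₀ : EuclideanSpace ℝ (Fin 3) → EuclideanSpace ℝ (Fin 3),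
    ContDiff ℝ (⊤ : ℕ∞) u₀ → NSWave0.IsDivFree u₀ → HasRapidSpatialDecay u₀ → AxEqv u₀ →
      ∃ K : ℝ≥0∞, K < ⊤ ∧ ∀ (T : ℝ) (u : ℝ → EuclideanSpace ℝ (Fin 3) → EuclideanSpace ℝ (Fin 3)),
        0 < T → IsKatoSolutionOn T ν u₀ u → ∀ t ∈ Set.Ico 0 T, MeasureTheory.eLpNorm (u t) 3 MeasureTheory.volume ≤ K

end Summit.NavierStokesRegularity.NavierStokesRegularity.Cruxes.AxisymmetricKatoGlobal.StrategistS20g11
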